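import Summits.KontsevichZagierPeriods.KontsevichZagierPeriods.Theorems.OctahedralSymmetryOctahedralSpanAllWeightsDefs
import Literature.NumberTheory.Transcendental.EllIterRepShuffle
import Mathlib.LinearAlgebra.Quotient.Basic
import Mathlib.Data.List.TakeWhile
import HarnessLib

/-!
# Block F1 of the crux `OctahedralSpanAllWeights` (stmt-KontsevichZagierPeriods-9659), line `Sketch`: tools and depth one

Helper file 1/3 for the stub `stub_regular_e0` (block F1 = the `e₀`-elimination inside the `e₁`-free
level-4 words) of the registered skeleton of the typed crux
`Summit.KontsevichZagierPeriods.OctahedralSymmetry.OctaSpan.OctahedralSpanAllWeights` (route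
`OctahedralSymmetry`, problem `KontsevichZagierPeriods`). Everything lives in the sub-namespace
`…OctaSpan.RegularE0` over the route vocabulary of `OctahedralSymmetryOctahedralSpanAllWeightsDefs`
(`WordQ`, `sym`, `toQ`, `fdsGen`, `liftMap`, `IsGen`, `rel`); `MZV.perm_of_mem_shuffleWord` is taken
from the tree (`EllIterRepShuffle`).

## Contents (all proved; finite combinatorics of words)

1. Tools: casting of term lists and shuffles into submodules (`toQ_ofTerms_mem`, `toQ_shuffle_mem`,
   `liftMap_sym_eq_sum`, `shuffleWord_singleton`, `list_sum_range_map`, `sum_map_sym_eq`,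
   `sym_mem_of_sum_mem`); the TARGET of
   block F1, `e0Lower W` = span of the convergent `e₁`-free words of the length of `W` with fewer letters
   `4` (`sym_mem_e0Lower`, `e0Lower_eq`); `rel` is a shuffle ideal (`liftMap_mem_rel`) and the LIFT
   PRINCIPLE `liftMap_mem_sup_e0Lower` (if `V` reduces then so does `u ш V` for every convergent unit word
   `u`); `isConvergentIdx_cons`; and ALL the definitions of the three files (`e0Lower`, `pref`, the
   depth-two words `X2 m a c₁ c₂ = 4^a c₁ 4^{m-a} c₂`, their target `T2 m` and classes `y2 m a c d`).
2. **Depth one, all weights** (registered helper stub `stub_regular_e0_top`): for `s ≥ 1` and a unit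
   pole `c = a·b` (`a, b, c ∈ {i, -1, -i}`) the finite double shuffle of `k = ((s, x_a))` (word
   `4^{s-1} a`) and `l = ((1, x_b))` (word `b`) reads `[4^{s-1} a c] + [b 4^{s-1} c] − [4^s c] − (4^{s-1} a) ш b
   ∈ rel`, the merged term `(s, x) ⋄ (1, y) = (s+1, x y)` carrying the extra letter `4`; all other words
   have `s - 1` letters `4`, no letter `0`, length `s + 1`, and are convergent (`depthOne_aux`,
   `depthOne`). Hence the stub's statement for `#4(W) + 1 = |W|` (`stub_regular_e0_top`; these words are
   `∓Li_{|W|}(c⁻¹)`).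

References: J. Zhao, Doc. Math. 15 (2010), §2 (words, Lemma 2.2, Def. 2.4, FDS) [Zhao2010];
M. E. Hoffman, J. Algebra 194 (1997), §2 [Hoffman1997]; C. Reutenauer, Free Lie Algebras (1993), §1.4.
-/

noncomputable section

namespace Summit.KontsevichZagierPeriods.OctahedralSymmetry.OctaSpan.RegularE0

open Literature.NumberTheory.Transcendental Literature.NumberTheory.Transcendental.LevelFour

/-- `toQ (ofTerms L)` lies in any submodule containing the basis vectors `[V]` of the words `V`
occurring in the term list `L`. [folklore] -/
theorem toQ_ofTerms_mem (T : Submodule ℚ WordQ) (L : List (ℤ × List (Fin 5)))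
    (h : ∀ p ∈ L, sym p.2 ∈ T) : toQ (ofTerms L) ∈ T := by
  induction L with
  | nil => simp
  | cons p L ih =>
    rw [ofTerms_cons, map_add, toQ_single]
    exact T.add_mem (zsmul_mem (h p (by simp)) _) (ih fun q hq => h q (by simp [hq]))

/-- The shuffle `u ш v` (cast to `WordQ`) lies in any submodule containing all interleavings of
`u` and `v`. [folklore] -/
theorem toQ_shuffle_mem (T : Submodule ℚ WordQ) (u v : List (Fin 5))
    (h : ∀ w ∈ MZV.shuffleWord u v, sym w ∈ T) : toQ (shuffle u v) ∈ T := by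
  refine toQ_ofTerms_mem T _ fun p hp => ?_
  obtain ⟨w, hw, rfl⟩ := List.mem_map.1 hp
  exact h w hw

/-- **The target of block F1**: the span of the convergent `e₁`-free words of the same length as `W`
with fewer letters `4` (poles `0`). [folklore] -/
abbrev e0Lower (W : List (Fin 5)) : Submodule ℚ WordQ :=
  Submodule.span ℚ (sym '' {V | V.length = W.length ∧ IsConvergent V ∧ V.count 0 = 0 ∧
    V.count 4 < W.count 4})

/-- A word with the four defining properties lies in `e0Lower W`. [folklore] -/
theorem sym_mem_e0Lower {W V : List (Fin 5)} (h1 : V.length = W.length) (h2 : IsConvergent V)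
    (h3 : V.count 0 = 0) (h4 : V.count 4 < W.count 4) : sym V ∈ e0Lower W :=
  Submodule.subset_span ⟨V, ⟨h1, h2, h3, h4⟩, rfl⟩

/-- `e0Lower W` only depends on the length of `W` and its number of letters `4`. [folklore] -/
theorem e0Lower_eq {V W : List (Fin 5)} (h1 : V.length = W.length) (h2 : V.count 4 = W.count 4) :
    e0Lower V = e0Lower W := by
  simp only [e0Lower, h1, h2]

/-- `liftMap u [V] = ∑_{w ∈ u ш V} [w]`: the shuffle lift of a basis vector is the plain sum of the basis
vectors of the interleavings. [folklore] -/
theorem liftMap_sym_eq_sum (u V : List (Fin 5)) :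
    liftMap u (sym V) = ((MZV.shuffleWord u V).map sym).sum := by
  have h1 : liftMap u (sym V) = toQ (shuffle u V) := by simp [liftMap, sym]
  rw [h1]
  unfold shuffle
  induction MZV.shuffleWord u V with
  | nil => simp
  | cons w L ih => rw [List.map_cons, ofTerms_cons, map_add, toQ_single, ih, List.map_cons,
      List.sum_cons, one_smul]

/-- **The relation module is a shuffle ideal**: `u ш rel ⊆ rel` for every convergent word `u` (lifts of
generators are generators, and `liftMap u` is linear). [cite: Zhao2010, §2 Lemma 2.2] -/
theorem liftMap_mem_rel {u : List (Fin 5)} (hu : IsConvergent u) {ρ : WordQ} (hρ : ρ ∈ rel) :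
    liftMap u ρ ∈ rel := by
  induction hρ using Submodule.span_induction with
  | mem x hx => exact mem_rel_of_isGen (IsGen.lift hu hx)
  | zero => simp
  | add x y _ _ hx hy => rw [map_add]; exact rel.add_mem hx hy
  | smul a x _ hx => rw [map_smul]; exact rel.smul_mem a hx

/-- **Lift principle for block F1.** If `V` reduces (modulo `rel`) to convergent `e₁`-free words of its
length with fewer letters `4`, then so does `u ш V` for every convergent UNIT word `u` (letters in
`{1, 2, 3}`), with respect to the word `u ++ V`: `rel` is a shuffle ideal and shuffling by `u` preserves
length differences, convergence, `e₁`-freeness and the number of letters `4`. In particular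
`[a V] ≡ −(the other insertions of a into V)` for a unit letter `a`: the recursion that moves unit letters
behind the first pole `0`. [folklore] -/
theorem liftMap_mem_sup_e0Lower {u V : List (Fin 5)} (hu : IsConvergent u) (hu0 : u.count 0 = 0)
    (hu4 : u.count 4 = 0) (hV : sym V ∈ rel ⊔ e0Lower V) :
    liftMap u (sym V) ∈ rel ⊔ e0Lower (u ++ V) := by
  rw [Submodule.mem_sup] at hV ⊢
  obtain ⟨r, hr, l, hl, hrl⟩ := hV
  refine ⟨liftMap u r, liftMap_mem_rel hu hr, liftMap u l, ?_, by rw [← map_add, hrl]⟩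
  refine Submodule.span_induction (p := fun x _ => liftMap u x ∈ e0Lower (u ++ V)) ?_ (by simp)
    (fun x y _ _ hx hy => by rw [map_add]; exact Submodule.add_mem _ hx hy)
    (fun a x _ hx => by rw [map_smul]; exact Submodule.smul_mem _ a hx) hl
  rintro _ ⟨V', ⟨h1, h2, h3, h4⟩, rfl⟩
  rw [liftMap_sym_eq_sum]
  refine list_sum_mem fun x hx => ?_
  obtain ⟨w, hw, rfl⟩ := List.mem_map.1 hx
  have hp := MZV.perm_of_mem_shuffleWord _ _ hw
  refine sym_mem_e0Lower ?_ (isConvergent_of_mem_shuffleWord hu h2 hw) ?_ ?_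
  · rw [hp.length_eq, List.length_append, List.length_append, h1]
  · rw [hp.count_eq, List.count_append, hu0, h3]
  · rw [hp.count_eq, List.count_append, List.count_append, hu4]; omega

/-- Convergence of an explicit index `(s, e) :: k`: all entries `≥ 1` and `(s, e) ≠ (1, 0)`. [folklore] -/
theorem isConvergentIdx_cons {s : ℕ} {e : Fin 4} {k : List (ℕ × Fin 4)} (hs : 1 ≤ s)
    (hse : s = 1 → e ≠ 0) (hk : ∀ p ∈ k, 1 ≤ p.1) : IsConvergentIdx ((s, e) :: k) := by
  refine ⟨fun p hp => ?_, fun p hp => ?_⟩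
  · rcases List.mem_cons.1 hp with rfl | hp
    · exact hs
    · exact hk p hp
  · simp only [List.head?_cons, Option.mem_def, Option.some.injEq] at hp
    subst hp
    intro h
    simp only [Prod.mk.injEq] at h
    exact hse h.1 h.2

/-- The shuffle of a single letter into a word is the list of its insertions, by position. [folklore] -/
theorem shuffleWord_singleton (c : Fin 5) : ∀ v : List (Fin 5),
    MZV.shuffleWord [c] v = (List.range (v.length + 1)).map fun j => v.take j ++ c :: v.drop j
  | [] => rfl
  | x :: v => by
    rw [MZV.shuffleWord_cons_cons, MZV.shuffleWord_nil_left, shuffleWord_singleton c v,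
      List.length_cons, List.range_succ_eq_map (n := v.length + 1)]
    simp [Function.comp_def]

/-- A list sum over `List.range` is the `Finset.range` sum. [folklore] -/
theorem list_sum_range_map (f : ℕ → WordQ) (n : ℕ) :
    ((List.range n).map f).sum = ∑ j ∈ Finset.range n, f j := by
  induction n with
  | zero => simp
  | succ n ih => rw [List.range_succ, List.map_append, List.sum_append, ih, Finset.sum_range_succ]; simp

/-- Splitting a sum of basis vectors along one word: `∑_{w ∈ L} [w] = (#occurrences of W) • [W] +
∑_{w ∈ L, w ≠ W} [w]`. [folklore] -/
theorem sum_map_sym_eq (L : List (List (Fin 5))) (W : List (Fin 5)) :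
    (L.map sym).sum = (L.count W : ℚ) • sym W + ((L.filter fun w => w ≠ W).map sym).sum := by
  induction L with
  | nil => simp
  | cons w L ih =>
    rw [List.map_cons, List.sum_cons, ih, List.count_cons, List.filter_cons]
    by_cases h : w = W
    · subst h
      simp only [beq_self_eq_true, ite_true, ne_eq, not_true_eq_false, decide_false, Nat.cast_add,
        Nat.cast_one, add_smul, one_smul, Bool.false_eq_true, ite_false]
      abel
    · have h1 : (w == W) = false := beq_eq_false_iff_ne.2 h
      simp only [h1, ite_false, add_zero, ne_eq, h, not_false_eq_true, decide_true, ite_true,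
        List.map_cons, List.sum_cons, Bool.false_eq_true]
      abel

/-- **Extraction**: if a sum of basis vectors lies in a submodule `T`, together with all its terms but
those equal to `[W]`, and `W` does occur, then `[W] ∈ T` (divide by the multiplicity). [folklore] -/
theorem sym_mem_of_sum_mem (T : Submodule ℚ WordQ) (L : List (List (Fin 5))) (W : List (Fin 5))
    (hW : W ∈ L) (hsum : (L.map sym).sum ∈ T) (hrest : ∀ w ∈ L, w ≠ W → sym w ∈ T) :
    sym W ∈ T := by
  have hcount : (L.count W : ℚ) ≠ 0 := by exact_mod_cast (List.count_pos_iff.2 hW).ne'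
  have hrest' : ((L.filter fun w => w ≠ W).map sym).sum ∈ T := by
    refine T.list_sum_mem fun x hx => ?_
    obtain ⟨w, hw, rfl⟩ := List.mem_map.1 hx
    rw [List.mem_filter] at hw
    exact hrest w hw.1 (by simpa using hw.2)
  have h : (L.count W : ℚ) • sym W ∈ T := by
    have := T.sub_mem hsum hrest'
    rwa [sum_map_sym_eq L W, add_sub_cancel_right] at this
  have := T.smul_mem ((L.count W : ℚ)⁻¹) h
  rwa [smul_smul, inv_mul_cancel₀ hcount, one_smul] at this

/-- Length of the maximal `4`-free prefix of a word (position of the first pole `0`). [folklore] -/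
def pref (W : List (Fin 5)) : ℕ := (W.takeWhile fun x => x ≠ 4).length

/-- The depth-two word `X(a, c₁, c₂) = 4^a c₁ 4^{m-a} c₂` of the layer `#4 = m`. [folklore] -/
def X2 (m a : ℕ) (c₁ c₂ : Fin 5) : List (Fin 5) :=
  List.replicate a 4 ++ c₁ :: (List.replicate (m - a) 4 ++ [c₂])

/-- `|X(a, c₁, c₂)| = m + 2`. [folklore] -/
theorem X2_length {m a : ℕ} (ha : a ≤ m) (c₁ c₂ : Fin 5) : (X2 m a c₁ c₂).length = m + 2 := by
  simp [X2]; omega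

/-- `X(a, c₁, c₂)` has `m` letters `4` (unit letters `c₁, c₂`). [folklore] -/
theorem X2_count_four {m a : ℕ} (ha : a ≤ m) {c₁ c₂ : Fin 5} (h1 : c₁ ≠ 4) (h2 : c₂ ≠ 4) :
    (X2 m a c₁ c₂).count 4 = m := by
  simp [X2, h1, h2]; omega

/-- Unit letters are not the letter `4`. [folklore] -/
theorem ne_four_of_unit {c : Fin 5} (hc : c = 1 ∨ c = 2 ∨ c = 3) : c ≠ 4 := by
  rcases hc with rfl | rfl | rfl <;> decide

/-- The lower span is the same for all words of the depth-two block. [folklore] -/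
theorem e0Lower_X2 {m a : ℕ} (ha : a ≤ m) {c d : Fin 5} (hc : c = 1 ∨ c = 2 ∨ c = 3)
    (hd : d = 1 ∨ d = 2 ∨ d = 3) : e0Lower (X2 m a c d) = e0Lower (X2 m 0 1 1) :=
  e0Lower_eq (by rw [X2_length ha, X2_length (Nat.zero_le _)])
    (by rw [X2_count_four ha (ne_four_of_unit hc) (ne_four_of_unit hd),
      X2_count_four (Nat.zero_le _) (by decide) (by decide)])

/-- The common target module `rel ⊔ (lower span)` of the depth-two block at layer `m`. [folklore] -/
def T2 (m : ℕ) : Submodule ℚ WordQ := rel ⊔ e0Lower (X2 m 0 1 1)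

/-- The unknowns of the depth-two block: classes of `[X(a, c, d)]` modulo `T2 m`. [folklore] -/
def y2 (m a : ℕ) (c d : Fin 5) : WordQ ⧸ T2 m := (T2 m).mkQ (sym (X2 m a c d))

/-- A two-term relation of the block becomes an equation between unknowns. [folklore] -/
theorem y2_eq_neg {m a₁ a₂ : ℕ} {c d c' d' : Fin 5} (ha₁ : a₁ ≤ m) (hc : c = 1 ∨ c = 2 ∨ c = 3)
    (hd : d = 1 ∨ d = 2 ∨ d = 3)
    (h : sym (X2 m a₁ c d) + sym (X2 m a₂ c' d') ∈ rel ⊔ e0Lower (X2 m a₁ c d)) :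
    y2 m a₁ c d = -y2 m a₂ c' d' := by
  rw [e0Lower_X2 ha₁ hc hd] at h
  have h0 : (T2 m).mkQ (sym (X2 m a₁ c d) + sym (X2 m a₂ c' d')) = 0 :=
    (Submodule.Quotient.mk_eq_zero _).2 h
  rw [map_add] at h0
  exact eq_neg_of_add_eq_zero_left h0

/-! ## Part 2. The depth-one family `4^s c` (all weights): one finite double shuffle

For `s ≥ 1` and a unit pole `c = a·b` (`a, b, c ∈ {i, -1, -i}`), the finite double shuffle of the
indices `k = ((s, x_a))` (word `4^{s-1} a`) and `l = ((1, x_b))` (word `b`) reads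
`[4^{s-1} a c] + [b 4^{s-1} c] − [4^s c] − (4^{s-1} a) ш b ∈ rel` (the merged term
`(s, x) ⋄ (1, y) = (s + 1, x y)` carries the extra letter `4`); every other word has `s - 1` letters `4`,
no letter `0`, length `s + 1` and is convergent. This is the layer `#4 = w - 1` of block F1 in every
weight `w = s + 1` (for `s = w - 1` these are `Li_w(-i), Li_w(-1), Li_w(i)` up to sign). -/
/-- The depth-one reduction with explicit exponents: `f, e ∈ (ℤ/4)∖{0}` with `f + e ≠ 0` encode the
poles `a = i^{-f}`, `b = i^{-e}`, `c = i^{-(f+e)} = a b`, all `≠ 1`. [cite: Zhao2010, §2 (FDS)] -/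
theorem depthOne_aux (s : ℕ) (hs : 1 ≤ s) (f e : Fin 4) (hf : f ≠ 0) (he : e ≠ 0) (hfe : f + e ≠ 0) :
    sym (List.replicate s 4 ++ [Fin.castSucc (-(f + e))]) ∈
      rel ⊔ e0Lower (List.replicate s 4 ++ [Fin.castSucc (-(f + e))]) := by
  have hcs0 : ∀ x : Fin 4, x ≠ 0 → Fin.castSucc x ≠ (0 : Fin 5) := by decide
  have hcs4 : ∀ x : Fin 4, Fin.castSucc x ≠ (4 : Fin 5) := by decide
  have ha0 : Fin.castSucc (-f) ≠ (0 : Fin 5) := hcs0 _ (neg_ne_zero.2 hf)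
  have hb0 : Fin.castSucc (-e) ≠ (0 : Fin 5) := hcs0 _ (neg_ne_zero.2 he)
  have hc0 : Fin.castSucc (-(f + e)) ≠ (0 : Fin 5) := hcs0 _ (neg_ne_zero.2 hfe)
  have ha4 := hcs4 (-f)
  have hb4 := hcs4 (-e)
  have hc4 := hcs4 (-(f + e))
  have hc0' : Fin.castSucc (-e + -f) ≠ (0 : Fin 5) := by rw [← neg_add_rev]; exact hc0
  have hc4' : Fin.castSucc (-e + -f) ≠ (4 : Fin 5) := by rw [← neg_add_rev]; exact hc4
  -- the indices `k = ((s, f))`, `l = ((1, e))` and the two inserted indices are convergent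
  have hk : IsConvergentIdx [(s, f)] := by
    refine ⟨fun p hp => ?_, fun p hp => ?_⟩
    · simp only [List.mem_singleton] at hp; subst hp; exact hs
    · simp only [List.head?_cons, Option.mem_def, Option.some.injEq] at hp; subst hp
      intro h; exact hf (by simpa using congrArg Prod.snd h)
  have hl : IsConvergentIdx [(1, e)] := by
    refine ⟨fun p hp => ?_, fun p hp => ?_⟩
    · simp only [List.mem_singleton] at hp; subst hp; exact le_rfl
    · simp only [List.head?_cons, Option.mem_def, Option.some.injEq] at hp; subst hp
      intro h; exact he (by simpa using congrArg Prod.snd h)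
  have hkl : IsConvergentIdx [(s, f), (1, e)] := by
    refine ⟨fun p hp => ?_, fun p hp => ?_⟩
    · simp only [List.mem_cons, List.not_mem_nil, or_false] at hp
      rcases hp with rfl | rfl
      · exact hs
      · exact le_rfl
    · simp only [List.head?_cons, Option.mem_def, Option.some.injEq] at hp; subst hp
      intro h; exact hf (by simpa using congrArg Prod.snd h)
  have hlk : IsConvergentIdx [(1, e), (s, f)] := by
    refine ⟨fun p hp => ?_, fun p hp => ?_⟩
    · simp only [List.mem_cons, List.not_mem_nil, or_false] at hp
      rcases hp with rfl | rfl
      · exact le_rfl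
      · exact hs
    · simp only [List.head?_cons, Option.mem_def, Option.some.injEq] at hp; subst hp
      intro h; exact he (by simpa using congrArg Prod.snd h)
  have hgen : fdsGen [(s, f)] [(1, e)] ∈ rel := mem_rel_of_isGen (IsGen.fds hk hl)
  -- the words of the five indices involved
  have hW1 : word [(s, f), (1, e)] =
      List.replicate (s - 1) 4 ++ [Fin.castSucc (-f), Fin.castSucc (-(f + e))] := by
    simp [word, wordAux]
  have hW2 : word [(1, e), (s, f)] =
      Fin.castSucc (-e) :: (List.replicate (s - 1) 4 ++ [Fin.castSucc (-(f + e))]) := by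
    simp [word, wordAux, add_comm e f]
  have hW3 : word [(s + 1, f + e)] = List.replicate s 4 ++ [Fin.castSucc (-(f + e))] := by
    simp [word, wordAux]
  have hwk : word [(s, f)] = List.replicate (s - 1) 4 ++ [Fin.castSucc (-f)] := by
    simp [word, wordAux]
  have hwl : word [(1, e)] = [Fin.castSucc (-e)] := by simp [word, wordAux]
  have hst : stuffleIdx [(s, f)] [(1, e)] = [[(s, f), (1, e)], [(1, e), (s, f)], [(s + 1, f + e)]] :=
    rfl
  -- the finite double shuffle, expanded
  have hfds : fdsGen [(s, f)] [(1, e)] =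
      sym (word [(s, f), (1, e)]) + sym (word [(1, e), (s, f)])
        - sym (List.replicate s 4 ++ [Fin.castSucc (-(f + e))])
        - toQ (shuffle (word [(s, f)]) (word [(1, e)])) := by
    simp only [fdsGen, stuffleSigned, hst, List.map_cons, List.map_nil, List.length_cons,
      List.length_nil, hW3, ofTerms_cons, ofTerms_nil, map_add, map_zero, toQ_single]
    norm_num
    abel
  -- the three lower terms
  have hlen : (List.replicate s 4 ++ [Fin.castSucc (-(f + e))]).length = s + 1 := by simp
  have hcnt : (List.replicate s 4 ++ [Fin.castSucc (-(f + e))]).count 4 = s := by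
    simp [hc4']
  have hT1 : sym (word [(s, f), (1, e)]) ∈
      e0Lower (List.replicate s 4 ++ [Fin.castSucc (-(f + e))]) := by
    refine sym_mem_e0Lower ?_ (isConvergent_word hkl) ?_ ?_
    · rw [hW1, hlen]; simp; omega
    · rw [hW1]; simp [List.count_replicate, ha0, hc0']
    · rw [hW1, hcnt]; simp [ha4, hc4']; omega
  have hT2 : sym (word [(1, e), (s, f)]) ∈
      e0Lower (List.replicate s 4 ++ [Fin.castSucc (-(f + e))]) := by
    refine sym_mem_e0Lower ?_ (isConvergent_word hlk) ?_ ?_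
    · rw [hW2, hlen]; simp; omega
    · rw [hW2]; simp [List.count_replicate, hb0, hc0']
    · rw [hW2, hcnt]; simp [hb4, hc4']; omega
  have hT3 : toQ (shuffle (word [(s, f)]) (word [(1, e)])) ∈
      e0Lower (List.replicate s 4 ++ [Fin.castSucc (-(f + e))]) := by
    refine toQ_shuffle_mem _ _ _ fun w hw => ?_
    have hp := MZV.perm_of_mem_shuffleWord _ _ hw
    refine sym_mem_e0Lower ?_ ?_ ?_ ?_
    · rw [hp.length_eq, hlen, hwk, hwl]; simp; omega
    · exact isConvergent_of_mem_shuffleWord (isConvergent_word hk) (isConvergent_word hl) hw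
    · rw [hp.count_eq, hwk, hwl]; simp [List.count_replicate, ha0, hb0]
    · rw [hp.count_eq, hcnt, hwk, hwl]; simp [ha4, hb4]; omega
  -- assemble
  rw [Submodule.mem_sup]
  refine ⟨-fdsGen [(s, f)] [(1, e)], rel.neg_mem hgen, _,
    Submodule.sub_mem _ (Submodule.add_mem _ hT1 hT2) hT3, ?_⟩
  rw [hfds]
  abel

/-- **The depth-one family, all weights.** For `s ≥ 1` and a unit pole letter `c ∈ {1, 2, 3}` the word
`4^s c` (`= ∓Li_{s+1}(c⁻¹)`) reduces modulo `rel` to convergent `e₁`-free words of the same length with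
fewer letters `4`. [cite: Zhao2010, §2 (FDS)] -/
theorem depthOne (s : ℕ) (hs : 1 ≤ s) (c : Fin 5) (hc : c = 1 ∨ c = 2 ∨ c = 3) :
    sym (List.replicate s 4 ++ [c]) ∈ rel ⊔ e0Lower (List.replicate s 4 ++ [c]) := by
  rcases hc with rfl | rfl | rfl
  · have h := depthOne_aux s hs 1 2 (by decide) (by decide) (by decide)
    rwa [show (Fin.castSucc (-(1 + 2) : Fin 4) : Fin 5) = 1 from by decide] at h
  · have h := depthOne_aux s hs 1 1 (by decide) (by decide) (by decide)
    rwa [show (Fin.castSucc (-(1 + 1) : Fin 4) : Fin 5) = 2 from by decide] at h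
  · have h := depthOne_aux s hs 2 3 (by decide) (by decide) (by decide)
    rwa [show (Fin.castSucc (-(2 + 3) : Fin 4) : Fin 5) = 3 from by decide] at h

/-- A word whose letters are all `4` except the last one is `4^s c`. [folklore] -/
theorem eq_replicate_append_of_count (W : List (Fin 5)) (hW : IsConvergent W)
    (htop : W.count 4 + 1 = W.length) :
    ∃ c : Fin 5, c ≠ 4 ∧ W = List.replicate (W.length - 1) 4 ++ [c] := by
  obtain ⟨W', c, rfl⟩ : ∃ W' c, W = W' ++ [c] := by
    cases W using List.reverseRecOn with
    | nil => simp at htop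
    | append_singleton W' c => exact ⟨W', c, rfl⟩
  have hc : c ≠ 4 := by
    intro h; subst h
    exact hW.2 (by simp)
  refine ⟨c, hc, ?_⟩
  have hcount : W'.count 4 = W'.length := by
    simp only [List.count_append, List.count_singleton', List.length_append,
      List.length_singleton] at htop
    rw [if_neg hc] at htop
    omega
  rw [List.count_eq_length] at hcount
  have hW' : W' = List.replicate W'.length 4 :=
    List.eq_replicate_iff.2 ⟨rfl, fun b hb => (hcount b hb).symm⟩
  simp only [List.length_append, List.length_singleton, Nat.add_sub_cancel]
  rw [← hW']

/-- **Block F1, top layer (`#4 = w − 1`, i.e. depth one), all weights.** The stub's statement under the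
extra hypothesis that all letters but the last are `4`. [cite: Zhao2010, §2 (FDS)] -/
theorem stub_regular_e0_top (W : List (Fin 5)) (hW : IsConvergent W) (h0 : W.count 0 = 0)
    (h4 : 0 < W.count 4) (htop : W.count 4 + 1 = W.length) :
    sym W ∈ rel ⊔ Submodule.span ℚ (sym '' {V | V.length = W.length ∧ IsConvergent V ∧
      V.count 0 = 0 ∧ V.count 4 < W.count 4}) := by
  obtain ⟨c, hc4, hWeq⟩ := eq_replicate_append_of_count W hW htop
  have hc0 : c ≠ 0 := by
    intro h; subst h
    have : (0 : Fin 5) ∈ W := by rw [hWeq]; simp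
    exact (List.count_pos_iff.2 this).ne' h0
  have key : ∀ c : Fin 5, c ≠ 4 → c ≠ 0 → (c = 1 ∨ c = 2 ∨ c = 3) := by decide
  have hc : c = 1 ∨ c = 2 ∨ c = 3 := key c hc4 hc0
  have hs : 1 ≤ W.length - 1 := by omega
  have h := depthOne (W.length - 1) hs c hc
  rw [← hWeq] at h
  exact h

end Summit.KontsevichZagierPeriods.OctahedralSymmetry.OctaSpan.RegularE0

end
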